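import Mathlib
import Summits.Parity.GeneralizedHardyLittlewood.Theorems.PrimeGapInitialSegmentPart2
import HarnessLib

/-!
# Prime-gap limit points: the cap on the initial segment `[0, 7·inf U]` and the density of `𝓛` on `[0, 7c]` (cell parity-ideate, p4 ROUNDS 13–16, line L9) — part 3/4 (`additiveLemma_holds` … `firstGap_core`)

Source: `HOME/parity-ideate-p4/round16/Sketch20.lean` (sha16 b835d559e74496fc, 4 997 lines, farm rc 0 / 0 warnings / 0 sorry /
axioms std-3; namespace `ParityIdeateP4R15`), §0–§3, cut by parity-ideate-p4 g19 (`ports/w7/build_w7.py`, pattern of lit g32's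
`ports/toruscap/build_toruscap.py`) to the dependency cone of the headline declarations `cap_first_period` (T ≤ 5m),
`cap_second_window` ([6m,7m]), `additiveLemma_holds` + `cap_first_gap` ([5m,6m]), `cap_le_seven`, `asymptoticCap4_le_seven`,
`fourPointFree_iff_triangleFree`, `fourPointFree_iff_delta4Free`, `primeGap_le_seven`, `primeGap_density_initial_segment`,
in a chain of 4 files of ≤ 400 lines (Theorems-side lint).  Statements byte-identical to the source EXCEPT (reuse, no
re-declaration): the vocabulary `BrauerFree`, `FourPointFree` and the lemma `brauerFree_of_fourPointFree` are the TREE's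
(`…Theorems.PrimeGapTorusCapPart1/Part6`, definitionally identical to the source's §0 `BrauerFree`/`FourPointFree`/
`FourPointFree.brauerFree`), the three dot-notation lemmas are renamed to flat names (`FourPointFree.delta4Free`/`.no_threeAP`/`.reflection` ↦ `fourPointFree_delta4Free`/`fourPointFree_no_threeAP`/`fourPointFree_reflection`) with their
five call sites rewritten, namespace `ParityIdeateP4R15` ↦ `Summit.Parity.GeneralizedHardyLittlewood.Theorems.PrimeGapInitialSegment`.
Non-Mathlib inputs: `Literature.NumberTheory.Sieve.PrimeGapLimitPoints` (`primeGapLimitSet`, `isClosed_primeGapLimitSet`, the NAMED fact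
`Merikoski2020_theorem1` = Merikoski 2020 Theorem 1, used HYPOTHESIS-STYLE, never asserted).  No `sorry`, no new axioms, no `instance`, no notation.
Cell-original mathematics (FRONTIER formalisation; record/instrument — nothing here bears on the parity problem): for a measurable
FOUR-POINT-FREE `U ⊆ (m,∞)` (no `x,y,z ∈ U` with `x+y, y+z, x+y+z ∈ U`) whose infimum `m ≥ 0` is approached from inside `U`,
`vol(U ∩ [0,T]) ≤ (T+m)/2` for every `T ≤ 7m` (one difference on `[0,5m]`; a reflection injection on `[6m,7m]`; one additive
lemma on the gap `[5m,6m]`); pay-off: given Merikoski's four-point theorem, with `c := sInf((0,∞) ∖ 𝓛)` the prime-gap limit-point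
set `𝓛` has `vol(𝓛 ∩ [0,T]) ≥ (T − c)/2` for all `0 ≤ T ≤ 7c` (print: `T/3`, [Merikoski2020GapLimitPoints, Cor. 2]).  The window
`(7m, 8m]` is OPEN (cell record: reduced to `HeavyBound`; pure cases proved; not in this port). HEADLINE DECLS IN THIS PART: `additiveLemma_holds`.
-/

open Set MeasureTheory Filter
namespace Summit.Parity.GeneralizedHardyLittlewood.Theorems.PrimeGapInitialSegment
open Summit.Parity.GeneralizedHardyLittlewood.Theorems.PrimeGapTorusCap (BrauerFree FourPointFree brauerFree_of_fourPointFree)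
open Literature.NumberTheory.Sieve
section FirstGap

/-- **THE ADDITIVE LEMMA HOLDS** — an elementary ONE-ANCHOR proof (no Raikov): for `b ∈ S` near `sup S`
the three sets `S ∩ [0,b)`, `(S ∩ [0,u−b)) + b` (no carry: avoids `R` by `(α)`) and
`(S ∩ [u−b,b)) + b − u` (carry: avoids `S ∪ R` by `(β)`) are pairwise disjoint, of total measure
`2·vol(S ∩ [0,b))`, inside `[0,u)` and disjoint from `R`; hence `2·vol S + vol R ≤ u`, and averaging with
`vol R ≤ u − τ` gives the lemma.  (The discrete analogue — the sup-anchored constraints alone already force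
the bound — is checked exhaustively for `n ≤ 13` in ROUND-14's notes.) -/
theorem additiveLemma_holds : AdditiveLemma := by
  intro u τ S R hu hτ0 hτu hSm hRm hSsub hRsub hdisj hα hβ
  have hRvol : volume R ≤ ENNReal.ofReal (u - τ) := (measure_mono hRsub).trans_eq Real.volume_Ico
  rcases S.eq_empty_or_nonempty with hS0 | hSne
  · rw [hS0, measure_empty, zero_add]
    exact hRvol.trans (ENNReal.ofReal_le_ofReal (by linarith))
  have hbdd : BddAbove S := ⟨u, fun s hs => (hSsub hs).2.le⟩
  have hle_sup : ∀ s ∈ S, s ≤ sSup S := fun s hs => le_csSup hbdd hs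
  have hc : 0 ≤ u - τ / 2 := by linarith
  have key : ∀ ε : ℝ, 0 < ε → volume S + volume R ≤ ENNReal.ofReal (u - τ / 2 + ε) := by
    intro ε hε
    obtain ⟨b, hbS, hb⟩ := exists_lt_of_lt_csSup hSne (show sSup S - ε < sSup S by linarith)
    have hb0 : 0 ≤ b := (hSsub hbS).1
    have hbu : b < u := (hSsub hbS).2
    set S₁ : Set ℝ := S ∩ Iio b with hS₁
    have hS₁m : MeasurableSet S₁ := hSm.inter measurableSet_Iio
    have hSε : volume S ≤ volume S₁ + ENNReal.ofReal ε := by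
      have hcov : S ⊆ S₁ ∪ Icc b (sSup S) := fun s hs => by
        rcases lt_or_ge s b with h | h
        · exact Or.inl ⟨hs, h⟩
        · exact Or.inr ⟨h, hle_sup s hs⟩
      calc volume S ≤ volume (S₁ ∪ Icc b (sSup S)) := measure_mono hcov
        _ ≤ volume S₁ + volume (Icc b (sSup S)) := measure_union_le _ _
        _ = volume S₁ + ENNReal.ofReal (sSup S - b) := by rw [Real.volume_Icc]
        _ ≤ volume S₁ + ENNReal.ofReal ε := by gcongr; linarith
    -- the two translates of `S₁` by the anchor `b`
    set W₂ : Set ℝ := (fun x : ℝ => x + -b) ⁻¹' (S₁ ∩ Iio (u - b)) with hW₂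
    set W₃ : Set ℝ := (fun x : ℝ => x + (u - b)) ⁻¹' (S₁ ∩ Ici (u - b)) with hW₃
    have hW₂m : MeasurableSet W₂ :=
      (hS₁m.inter measurableSet_Iio).preimage (measurable_id.add_const _)
    have hW₃m : MeasurableSet W₃ :=
      (hS₁m.inter measurableSet_Ici).preimage (measurable_id.add_const _)
    have hW₂vol : volume W₂ = volume (S₁ ∩ Iio (u - b)) := measure_preimage_add_right _ _ _
    have hW₃vol : volume W₃ = volume (S₁ ∩ Ici (u - b)) := measure_preimage_add_right _ _ _
    have hS₁split : volume S₁ = volume (S₁ ∩ Iio (u - b)) + volume (S₁ ∩ Ici (u - b)) := by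
      have e : S₁ = S₁ ∩ Iio (u - b) ∪ S₁ ∩ Ici (u - b) := by
        ext t; simp only [mem_union, mem_inter_iff, mem_Iio, mem_Ici]
        constructor
        · intro ht; rcases lt_or_ge t (u - b) with h | h
          · exact Or.inl ⟨ht, h⟩
          · exact Or.inr ⟨ht, h⟩
        · rintro (⟨ht, _⟩ | ⟨ht, _⟩) <;> exact ht
      have hd : Disjoint (S₁ ∩ Iio (u - b)) (S₁ ∩ Ici (u - b)) :=
        Set.disjoint_left.2 fun t ht ht' => by
          have h1 : t < u - b := ht.2
          have h2 : u - b ≤ t := ht'.2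
          linarith
      rw [← measure_union hd (hS₁m.inter measurableSet_Ici), ← e]
    -- containments
    have hS₁sub : S₁ ⊆ Ico 0 u := fun x hx => hSsub hx.1
    have hW₂sub : W₂ ⊆ Ico b u := fun x hx => by
      have h1 : 0 ≤ x + -b := (hSsub hx.1.1).1
      have h2 : x + -b < u - b := hx.2
      exact ⟨by linarith, by linarith⟩
    have hW₃sub : W₃ ⊆ Ico 0 b := fun x hx => by
      have h1 : u - b ≤ x + (u - b) := hx.2
      have h2 : x + (u - b) < b := hx.1.2
      exact ⟨by linarith, by linarith⟩
    -- disjointness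
    have hd12 : Disjoint S₁ W₂ := Set.disjoint_left.2 fun x hx hx' => by
      have h1 : x < b := hx.2
      have h2 : b ≤ x := (hW₂sub hx').1
      linarith
    have hd3 : Disjoint (S₁ ∪ W₂) W₃ := Set.disjoint_left.2 fun x hx hx₃ => by
      rcases hx with hx₁ | hx₂
      · -- carry: `x = s + b - u` with `s ∈ S`, so `x ∉ S`
        have hs : x + (u - b) ∈ S := hx₃.1.1
        have h0 : u - b ≤ x + (u - b) := hx₃.2
        have hle : u ≤ x + (u - b) + b := by linarith
        have h := (hβ _ hs b hbS hle).1
        have e : x + (u - b) + b - u = x := by ring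
        rw [e] at h
        exact h hx₁.1
      · have h1 : b ≤ x := (hW₂sub hx₂).1
        have h2 : x < b := (hW₃sub hx₃).2
        linarith
    -- all three avoid `R`
    have hWR : Disjoint (S₁ ∪ W₂ ∪ W₃) R := Set.disjoint_left.2 fun x hx hxR => by
      rcases hx with (hx₁ | hx₂) | hx₃
      · exact Set.disjoint_left.1 hdisj hx₁.1 hxR
      · have hs : x + -b ∈ S := hx₂.1.1
        have h0 : x < u := (hW₂sub hx₂).2
        have hlt : x + -b + b < u := by linarith
        have h := hα _ hs b hbS hlt
        have e : x + -b + b = x := by ring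
        rw [e] at h
        exact h hxR
      · have hs : x + (u - b) ∈ S := hx₃.1.1
        have h0 : u - b ≤ x + (u - b) := hx₃.2
        have hle : u ≤ x + (u - b) + b := by linarith
        have h := (hβ _ hs b hbS hle).2
        have e : x + (u - b) + b - u = x := by ring
        rw [e] at h
        exact h hxR
    -- measure count: `2 vol S₁ + vol R ≤ u`
    have hsub : S₁ ∪ W₂ ∪ W₃ ∪ R ⊆ Ico 0 u :=
      union_subset (union_subset (union_subset hS₁sub
        (fun x hx => ⟨hb0.trans (hW₂sub hx).1, (hW₂sub hx).2⟩))
        (fun x hx => ⟨(hW₃sub hx).1, (hW₃sub hx).2.trans hbu⟩))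
        (fun x hx => ⟨hτ0.trans (hRsub hx).1, (hRsub hx).2⟩)
    have hcount : 2 * volume S₁ + volume R ≤ ENNReal.ofReal u := by
      calc 2 * volume S₁ + volume R
          = volume S₁ + volume W₂ + volume W₃ + volume R := by
            rw [two_mul, hW₂vol, hW₃vol, hS₁split]; ring
        _ = volume (S₁ ∪ W₂ ∪ W₃ ∪ R) := by
            rw [measure_union hWR hRm, measure_union hd3 hW₃m, measure_union hd12 hW₂m]
        _ ≤ volume (Ico (0:ℝ) u) := measure_mono hsub
        _ = ENNReal.ofReal u := by simp [Real.volume_Ico]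
    -- average with `vol R ≤ u - τ` and halve
    have h2 : 2 * (volume S₁ + volume R) ≤ ENNReal.ofReal (2 * u - τ) := by
      calc 2 * (volume S₁ + volume R) = 2 * volume S₁ + volume R + volume R := by ring
        _ ≤ ENNReal.ofReal u + ENNReal.ofReal (u - τ) := add_le_add hcount hRvol
        _ = ENNReal.ofReal (2 * u - τ) := by
            rw [← ENNReal.ofReal_add hu.le (by linarith)]; congr 1; ring
    have hhalf : volume S₁ + volume R ≤ ENNReal.ofReal (u - τ / 2) := by
      have e : u - τ / 2 = (2 * u - τ) / 2 := by ring
      rw [e, ENNReal.ofReal_div_of_pos (by norm_num : (0:ℝ) < 2), ENNReal.ofReal_ofNat,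
        ENNReal.le_div_iff_mul_le (Or.inl (by norm_num)) (Or.inl (by simp)), mul_comm]
      exact h2
    calc volume S + volume R ≤ volume S₁ + ENNReal.ofReal ε + volume R := by gcongr
      _ = (volume S₁ + volume R) + ENNReal.ofReal ε := by ring
      _ ≤ ENNReal.ofReal (u - τ / 2) + ENNReal.ofReal ε := by gcongr
      _ = ENNReal.ofReal (u - τ / 2 + ε) := by rw [← ENNReal.ofReal_add hc hε.le]
  refine ENNReal.le_of_forall_pos_le_add fun ε hε _ => ?_
  calc volume S + volume R ≤ ENNReal.ofReal (u - τ / 2 + ε) := key ε (by exact_mod_cast hε)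
    _ = ENNReal.ofReal (u - τ / 2) + ε := by
        rw [ENNReal.ofReal_add hc ε.coe_nonneg, ENNReal.ofReal_coe_nnreal]

variable {U : Set ℝ}
/-- The core of the first gap: for `u ∈ U` (`U` four-point-free) and `0 ≤ τ ≤ u`,
`vol(U ∩ [u, 5u+τ)) ≤ 3u + τ/2`, GIVEN the additive lemma. -/
theorem firstGap_core (hAL : AdditiveLemma) (hUm : MeasurableSet U) (h4 : FourPointFree U) {u : ℝ}
    (hu : 0 < u) (huU : u ∈ U) {τ : ℝ} (hτ0 : 0 ≤ τ) (hτu : τ ≤ u) :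
    volume (U ∩ Ico u (5 * u + τ)) ≤ ENNReal.ofReal (3 * u + τ / 2) := by
  set L : ℝ → Set ℝ := fun k => (fun t : ℝ => t + k * u) ⁻¹' U ∩ Ico 0 u with hL
  have hLm : ∀ k, MeasurableSet (L k) := fun k =>
    (hUm.preimage (measurable_id.add_const _)).inter measurableSet_Ico
  have memL : ∀ {k t : ℝ}, t ∈ L k ↔ t + k * u ∈ U ∧ 0 ≤ t ∧ t < u := fun {k t} => by
    simp [hL, mem_Ico]
  have hpiece : ∀ k : ℝ, volume (U ∩ Ico (k * u) (k * u + u)) = volume (L k) := by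
    intro k
    have e : L k = (fun t : ℝ => t + k * u) ⁻¹' (U ∩ Ico (k * u) (k * u + u)) := by
      ext t
      simp only [hL, mem_inter_iff, mem_preimage, mem_Ico]
      constructor
      · rintro ⟨h1, h2, h3⟩; exact ⟨h1, by linarith, by linarith⟩
      · rintro ⟨h1, h2, h3⟩; exact ⟨h1, by linarith, by linarith⟩
    rw [e, measure_preimage_add_right]
  have hpiece5 : volume (U ∩ Ico (5 * u) (5 * u + τ)) = volume (L 5 ∩ Iio τ) := by
    have e : L 5 ∩ Iio τ = (fun t : ℝ => t + 5 * u) ⁻¹' (U ∩ Ico (5 * u) (5 * u + τ)) := by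
      ext t
      simp only [hL, mem_inter_iff, mem_preimage, mem_Ico, mem_Iio]
      constructor
      · rintro ⟨⟨h1, h2, h3⟩, h4⟩; exact ⟨h1, by linarith, by linarith⟩
      · rintro ⟨h1, h2, h3⟩; exact ⟨⟨h1, by linarith, by linarith⟩, by linarith⟩
    rw [e, measure_preimage_add_right]
  have hcover : U ∩ Ico u (5 * u + τ) ⊆
      U ∩ Ico (1 * u) (1 * u + u) ∪ U ∩ Ico (2 * u) (2 * u + u) ∪ U ∩ Ico (3 * u) (3 * u + u) ∪
        U ∩ Ico (4 * u) (4 * u + u) ∪ U ∩ Ico (5 * u) (5 * u + τ) := by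
    rintro x ⟨hxU, hx1, hx2⟩
    rcases lt_or_ge x (2 * u) with h2 | h2
    · exact Or.inl (Or.inl (Or.inl (Or.inl ⟨hxU, by linarith, by linarith⟩)))
    rcases lt_or_ge x (3 * u) with h3 | h3
    · exact Or.inl (Or.inl (Or.inl (Or.inr ⟨hxU, by linarith, by linarith⟩)))
    rcases lt_or_ge x (4 * u) with h4' | h4'
    · exact Or.inl (Or.inl (Or.inr ⟨hxU, by linarith, by linarith⟩))
    rcases lt_or_ge x (5 * u) with h5 | h5
    · exact Or.inl (Or.inr ⟨hxU, by linarith, by linarith⟩)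
    · exact Or.inr ⟨hxU, h5, hx2⟩
  set B : ℝ → Set ℝ := fun k => L k ∩ Ici τ with hB
  set C : ℝ → Set ℝ := fun k => L k ∩ Iio τ with hC
  have hBm : ∀ k, MeasurableSet (B k) := fun k => (hLm k).inter measurableSet_Ici
  have hCm : ∀ k, MeasurableSet (C k) := fun k => (hLm k).inter measurableSet_Iio
  have hsplit : ∀ k, volume (L k) = volume (B k) + volume (C k) := by
    intro k
    have e : L k = B k ∪ C k := by
      ext t; simp only [hB, hC, mem_union, mem_inter_iff, mem_Ici, mem_Iio]
      constructor
      · intro ht; rcases le_or_gt τ t with h | h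
        · exact Or.inl ⟨ht, h⟩
        · exact Or.inr ⟨ht, h⟩
      · rintro (⟨ht, _⟩ | ⟨ht, _⟩) <;> exact ht
    have hd : Disjoint (B k) (C k) := Set.disjoint_left.2 fun t htB htC => by
      have h1 : τ ≤ t := htB.2
      have h2 : t < τ := htC.2
      linarith
    rw [e, measure_union hd (hCm k)]
  have hBS : ∀ k, B k ⊆ Ico τ u := fun k t ht => ⟨ht.2, (memL.1 ht.1).2.2⟩
  have hCS : ∀ k, C k ⊆ Ico 0 τ := fun k t ht => ⟨(memL.1 ht.1).2.1, ht.2⟩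
  have hAP : ∀ (k : ℝ) (t : ℝ), t ∈ L k → t ∈ L (k + 1) → t ∈ L (k + 2) → False := by
    intro k t h0 h1 h2
    have h0' := (memL.1 h0).1
    have h1' := (memL.1 h1).1
    have h2' := (memL.1 h2).1
    refine fourPointFree_no_threeAP h4 huU h0' ?_ ?_
    · have e : t + k * u + u = t + (k + 1) * u := by ring
      rwa [e]
    · have e : t + k * u + 2 * u = t + (k + 2) * u := by ring
      rwa [e]
  -- lines below τ (five positions): `≤ 3τ + heavy`
  have hC5 : volume (C 1) + volume (C 2) + volume (C 3) + volume (C 4) + volume (C 5) ≤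
      volume (Ico 0 τ) + volume (Ico 0 τ) + volume (Ico 0 τ) + volume (C 1 ∩ C 2 ∩ C 4 ∩ C 5) :=
    measure_five_le (hCm 1) (hCm 2) (hCm 3) (hCm 4) (hCm 5) (hCS 1) (hCS 2) (hCS 3) (hCS 4) (hCS 5)
      (fun t ht1 ht2 ht3 => hAP 1 t ht1.1 (by norm_num; exact ht2.1) (by norm_num; exact ht3.1))
      (fun t ht3 ht4 ht5 => hAP 3 t ht3.1 (by norm_num; exact ht4.1) (by norm_num; exact ht5.1))
  -- lines above τ (four positions): `≤ 2(u − τ) + weight-three`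
  have hB4 : volume (B 1) + volume (B 2) + volume (B 3) + volume (B 4) ≤
      volume (Ico τ u) + volume (Ico τ u) + volume (B 1 ∩ B 4 ∩ (B 2 ∪ B 3)) :=
    measure_four_le (hBm 1) (hBm 2) (hBm 3) (hBm 4) (hBS 1) (hBS 2) (hBS 3) (hBS 4)
      (fun t ht1 ht2 ht3 => hAP 1 t ht1.1 (by norm_num; exact ht2.1) (by norm_num; exact ht3.1))
      (fun t ht2 ht3 ht4 => hAP 2 t ht2.1 (by norm_num; exact ht3.1) (by norm_num; exact ht4.1))
  -- the two sets of the additive lemma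
  set S : Set ℝ := L 1 ∩ L 2 ∩ L 4 with hSdef
  set R : Set ℝ := L 3 ∩ L 4 ∩ Ici τ with hRdef
  have hSm : MeasurableSet S := ((hLm 1).inter (hLm 2)).inter (hLm 4)
  have hRm : MeasurableSet R := ((hLm 3).inter (hLm 4)).inter measurableSet_Ici
  have hSsub : S ⊆ Ico 0 u := fun t ht => (memL.1 ht.2).2
  have hRsub : R ⊆ Ico τ u := fun t ht => ⟨ht.2, (memL.1 ht.1.2).2.2⟩
  have hdisj : Disjoint S R := Set.disjoint_left.2 fun t htS htR =>
    hAP 2 t htS.1.2 (by norm_num; exact htR.1.1) (by norm_num; exact htR.1.2)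
  have hα : ∀ s ∈ S, ∀ s' ∈ S, s + s' < u → s + s' ∉ R := by
    intro s hs s' hs' hlt hR
    have hs2 : s + 2 * u ∈ U := (memL.1 hs.1.2).1
    have hs'1 : s' + 1 * u ∈ U := (memL.1 hs'.1.1).1
    have hs'2 : s' + 2 * u ∈ U := (memL.1 hs'.1.2).1
    have hR3 : s + s' + 3 * u ∈ U := (memL.1 hR.1.1).1
    have hR4 : s + s' + 4 * u ∈ U := (memL.1 hR.1.2).1
    refine h4 (s + 2 * u) (s' + 1 * u) u hs2 hs'1 huU ?_ ?_ ?_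
    · have e : s + 2 * u + (s' + 1 * u) = s + s' + 3 * u := by ring
      rwa [e]
    · have e : s' + 1 * u + u = s' + 2 * u := by ring
      rwa [e]
    · have e : s + 2 * u + (s' + 1 * u) + u = s + s' + 4 * u := by ring
      rwa [e]
  have hno4 : ∀ s ∈ S, ∀ s' ∈ S, s + s' + 3 * u ∉ U := by
    intro s hs s' hs' hmem
    have hs1 : s + 1 * u ∈ U := (memL.1 hs.1.1).1
    have hs2 : s + 2 * u ∈ U := (memL.1 hs.1.2).1
    have hs'1 : s' + 1 * u ∈ U := (memL.1 hs'.1.1).1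
    have hs'2 : s' + 2 * u ∈ U := (memL.1 hs'.1.2).1
    refine h4 (s + 1 * u) u (s' + 1 * u) hs1 huU hs'1 ?_ ?_ ?_
    · have e : s + 1 * u + u = s + 2 * u := by ring
      rwa [e]
    · have e : u + (s' + 1 * u) = s' + 2 * u := by ring
      rwa [e]
    · have e : s + 1 * u + u + (s' + 1 * u) = s + s' + 3 * u := by ring
      rwa [e]
  have hβ : ∀ s ∈ S, ∀ s' ∈ S, u ≤ s + s' → s + s' - u ∉ S ∧ s + s' - u ∉ R := by
    intro s hs s' hs' hle
    have key : s + s' - u ∉ L 4 := fun hmem => by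
      have h := (memL.1 hmem).1
      have e : s + s' - u + 4 * u = s + s' + 3 * u := by ring
      rw [e] at h
      exact hno4 s hs s' hs' h
    exact ⟨fun h => key h.2, fun h => key h.1.2⟩
  have hadd : volume S + volume R ≤ ENNReal.ofReal (u - τ / 2) :=
    hAL u τ S R hu hτ0 hτu hSm hRm hSsub hRsub hdisj hα hβ
  -- heavy / weight-three lines are controlled by `S` and `R`
  have hSsplit : volume S = volume (S ∩ Iio τ) + volume (S ∩ Ici τ) := by
    have e : S = S ∩ Iio τ ∪ S ∩ Ici τ := by
      ext t; simp only [mem_union, mem_inter_iff, mem_Iio, mem_Ici]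
      constructor
      · intro ht; rcases lt_or_ge t τ with h | h
        · exact Or.inl ⟨ht, h⟩
        · exact Or.inr ⟨ht, h⟩
      · rintro (⟨ht, _⟩ | ⟨ht, _⟩) <;> exact ht
    have hd : Disjoint (S ∩ Iio τ) (S ∩ Ici τ) := Set.disjoint_left.2 fun t ht ht' => by
      have h1 : t < τ := ht.2
      have h2 : τ ≤ t := ht'.2
      linarith
    rw [← measure_union hd (hSm.inter measurableSet_Ici), ← e]
  have hheavy : volume (C 1 ∩ C 2 ∩ C 4 ∩ C 5) ≤ volume (S ∩ Iio τ) :=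
    measure_mono fun t ht => ⟨⟨⟨ht.1.1.1.1, ht.1.1.2.1⟩, ht.1.2.1⟩, ht.2.2⟩
  have hthree : volume (B 1 ∩ B 4 ∩ (B 2 ∪ B 3)) ≤ volume (S ∩ Ici τ) + volume R := by
    calc volume (B 1 ∩ B 4 ∩ (B 2 ∪ B 3)) ≤ volume (S ∩ Ici τ ∪ R) := measure_mono fun t ht => by
            rcases ht.2 with h2 | h3
            · exact Or.inl ⟨⟨⟨ht.1.1.1, h2.1⟩, ht.1.2.1⟩, ht.1.1.2⟩
            · exact Or.inr ⟨⟨h3.1, ht.1.2.1⟩, ht.1.1.2⟩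
      _ ≤ volume (S ∩ Ici τ) + volume R := measure_union_le _ _
  -- assemble
  have hIco0 : volume (Ico 0 τ) = ENNReal.ofReal τ := by simp [Real.volume_Ico]
  have hIcoτ : volume (Ico τ u) = ENNReal.ofReal (u - τ) := Real.volume_Ico
  calc volume (U ∩ Ico u (5 * u + τ))
      ≤ volume (U ∩ Ico (1 * u) (1 * u + u) ∪ U ∩ Ico (2 * u) (2 * u + u) ∪
          U ∩ Ico (3 * u) (3 * u + u) ∪ U ∩ Ico (4 * u) (4 * u + u) ∪
          U ∩ Ico (5 * u) (5 * u + τ)) := measure_mono hcover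
    _ ≤ volume (U ∩ Ico (1 * u) (1 * u + u)) + volume (U ∩ Ico (2 * u) (2 * u + u)) +
          volume (U ∩ Ico (3 * u) (3 * u + u)) + volume (U ∩ Ico (4 * u) (4 * u + u)) +
          volume (U ∩ Ico (5 * u) (5 * u + τ)) := by
        refine (measure_union_le _ _).trans ?_; gcongr
        refine (measure_union_le _ _).trans ?_; gcongr
        refine (measure_union_le _ _).trans ?_; gcongr
        exact measure_union_le _ _
    _ = volume (L 1) + volume (L 2) + volume (L 3) + volume (L 4) + volume (L 5 ∩ Iio τ) := by
        rw [hpiece, hpiece, hpiece, hpiece, hpiece5]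
    _ = (volume (B 1) + volume (B 2) + volume (B 3) + volume (B 4)) +
          (volume (C 1) + volume (C 2) + volume (C 3) + volume (C 4) + volume (C 5)) := by
        rw [hsplit, hsplit, hsplit, hsplit]
        show _ = _ + (volume (C 1) + volume (C 2) + volume (C 3) + volume (C 4) + volume (L 5 ∩ Iio τ))
        ring
    _ ≤ (volume (Ico τ u) + volume (Ico τ u) + volume (B 1 ∩ B 4 ∩ (B 2 ∪ B 3))) +
          (volume (Ico 0 τ) + volume (Ico 0 τ) + volume (Ico 0 τ) + volume (C 1 ∩ C 2 ∩ C 4 ∩ C 5)) :=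
        add_le_add hB4 hC5
    _ ≤ (volume (Ico τ u) + volume (Ico τ u) + (volume (S ∩ Ici τ) + volume R)) +
          (volume (Ico 0 τ) + volume (Ico 0 τ) + volume (Ico 0 τ) + volume (S ∩ Iio τ)) := by
        gcongr
    _ = volume (Ico τ u) + volume (Ico τ u) + (volume (Ico 0 τ) + volume (Ico 0 τ) + volume (Ico 0 τ)) +
          (volume S + volume R) := by rw [hSsplit]; ring
    _ ≤ ENNReal.ofReal (u - τ) + ENNReal.ofReal (u - τ) +
          (ENNReal.ofReal τ + ENNReal.ofReal τ + ENNReal.ofReal τ) + ENNReal.ofReal (u - τ / 2) := by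
        rw [hIco0, hIcoτ]; gcongr
    _ = ENNReal.ofReal (3 * u + τ / 2) := by
        have h1 : 0 ≤ u - τ := by linarith
        rw [← ENNReal.ofReal_add h1 h1, ← ENNReal.ofReal_add hτ0 hτ0,
          ← ENNReal.ofReal_add (by linarith) hτ0, ← ENNReal.ofReal_add (by linarith) (by linarith),
          ← ENNReal.ofReal_add (by linarith) (by linarith)]
        congr 1; ring

end FirstGap
end Summit.Parity.GeneralizedHardyLittlewood.Theorems.PrimeGapInitialSegment
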